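import Summits.BirchSwinnertonDyer.BirchSwinnertonDyer.Theorems.ResidualThetaTransportAtTwoSignedMuSeedAtTwoPlusTiltTranslation
import Summits.BirchSwinnertonDyer.BirchSwinnertonDyer.Theorems.ResidualThetaTransportAtTwoSignedMuSeedAtTwoPlusTiltEngine
import HarnessLib

/-!
# Seed crux `SignedMuSeedAtTwoPlus` (stmt-BirchSwinnertonDyer-21438), line `norm-field-tilt`:
# the tilt engine's inference for the ACTUAL tower — Lubin–Tate datum `(A, π, 4, f)`, Weierstrass model, orbit doubling

Cell `bsd-wall`, width seat `bsd-wall-rtt-p4-w2` g10; assembly of p657933 (`…TiltEngine`: `NonDeg(m₀) ⟹ OddDigit(m)`,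
`m ≥ m₀ + 2`, for an abstract level structure), p657707 (`…TiltFormalGroup`: S2's hypotheses for the chord–tangent law)
and p658253 (`…TiltTranslation`: item (c), `[1 + π^{m+1}w]‾ = t ⊕ ([w]‾t)^{4^{m+1}}`).  HONEST FRAMING: THEOREMS ONLY;
closes no item; the line is NOT registered; BSD is NOT proved by this.

## What is proved

`oddDigit_of_nonDeg_lubinTate`: let `(A, π, q = 4, f)` be a Lubin–Tate datum (`IsLTRing π 4`, `IsLTSeries π 4 f`; the
line: `A = ℤ₄ = 𝒪_{ℚ₄}`, `π = −2`, `f = i([2]X)`, the RTT files' relative Lubin–Tate setting), `k = A/π` a domain (then of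
characteristic `2`), `U/A` a Weierstrass model with `U.formalGroupLaw = F_f` (`formalGroupLaw_eq_ltF'`) and `a₁(U) ≡ 0`
(supersingular reduction), `η̄` the inverse invariant differential of `U ⊗ k`, and `w_m ∈ A ∖ (π)` (so
`h_m := 1 + π^{m+1}w_m` is the card's `g^{2^m}`).  For level data `Z_m, S_m ∈ k⟦t⟧` with `Z_m ≠ 0`, `Z_m·S_m = η̄·Z_m'`
(`S_m = D log Z_m`), the ORBIT DOUBLING `Z_{m+1} = Z_m · Z_m([h_m]‾ t)`, `ord Z_m = 2^{m+2}`, and digits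
`Z_m ≡ P_m(s_m) (mod t^{3·4^m})`:  **`ord S_{m₀} = a₀`, `a₀ + 2 < 4^{m₀+1}` ⟹ for every `m ≥ m₀ + 2` some odd-degree
coefficient of `P_m` is non-zero.**  Every hypothesis of the abstract engine about the translations (`y_m(0) = 0`,
`y_m' = 0`, `ord y_m = 4^{m+1}`, the shape `t ⊕ y_m = t + η̄ y_m + y_m² r_m`, the invariance `η̄ (t ⊕ y_m)' = η̄(t ⊕ y_m)`,
`η̄' = 0`, and `[h_m]‾ = t ⊕ y_m`) is DISCHARGED here; what is left to the line's stub S1 is only the orbit product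
`Z_m = Z'_{ρ,m}` itself with its valuation and membership, and to stub S4 the non-degeneracy `NonDeg(m₀)`.
Auxiliary: `charP_two_of_isLTRing_four` (`q = 4 ⟹ char k = 2`). [folklore]
-/

noncomputable section

set_option autoImplicit false
set_option linter.dupNamespace false

open PowerSeries
open Literature.NumberTheory.GaloisRepresentations

namespace Summit.BirchSwinnertonDyer.BirchSwinnertonDyer.Theorems.SignedMuAtTwo.Tilt

variable {A : Type*} [CommRing A] {π : A}

/-- For a Lubin–Tate ring with `q = 4` the residue ring `A/π` has characteristic `2` (if non-trivial). [folklore] -/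
theorem charP_two_of_isLTRing_four (hA : LubinTate.IsLTRing π 4) [Nontrivial (A ⧸ Ideal.span {π})] :
    CharP (A ⧸ Ideal.span {π}) 2 := by
  obtain ⟨p, r, hp, h4, hpmem⟩ := hA.exists_prime
  have hr : 0 < r := by
    rcases Nat.eq_zero_or_pos r with h | h
    · subst h; simp at h4
    · exact h
  have hp2 : p = 2 := by
    have h4' : p ∣ 4 := by rw [h4]; exact dvd_pow_self p hr.ne'
    have hdvd : p ∣ 2 ^ 2 := by norm_num; exact h4'
    exact (Nat.prime_dvd_prime_iff_eq hp Nat.prime_two).mp (hp.dvd_of_dvd_pow hdvd)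
  subst hp2
  refine (CharP.charP_iff_prime_eq_zero Nat.prime_two).mpr ?_
  rw [show ((2 : ℕ) : A ⧸ Ideal.span {π}) = Ideal.Quotient.mk (Ideal.span {π}) (2 : A) by
      rw [Nat.cast_ofNat, map_ofNat], Ideal.Quotient.eq_zero_iff_mem]
  exact_mod_cast hpmem

/-- **The tilt engine for the actual tower.**  See the module docstring.  [folklore] -/
theorem oddDigit_of_nonDeg_lubinTate (hA : LubinTate.IsLTRing π 4) {f : PowerSeries A}
    (hf : LubinTate.IsLTSeries π 4 f) [IsDomain (A ⧸ Ideal.span {π})]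
    (U : WeierstrassCurve A) (hU : U.formalGroupLaw = LubinTate.ltF hA hf)
    (ha₁ : (U.map (Ideal.Quotient.mk (Ideal.span {π}))).a₁ = 0)
    (w : ℕ → A) (hw : ∀ m, w m ∉ Ideal.span {π})
    (Z S s : ℕ → PowerSeries (A ⧸ Ideal.span {π})) (P : ℕ → Polynomial (A ⧸ Ideal.span {π}))
    (hZ : ∀ m, Z m ≠ 0)
    (hZS : ∀ m, Z m * S m = (U.map (Ideal.Quotient.mk (Ideal.span {π}))).formalEta *
      d⁄dX (A ⧸ Ideal.span {π}) (Z m))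
    (hZstep : ∀ m, Z (m + 1) = Z m * (Z m).subst
      ((LubinTate.hom hA hf hf (1 + π ^ (m + 1) * w m)).map (Ideal.Quotient.mk (Ideal.span {π}))))
    (hZord : ∀ m, (Z m).order = (2 ^ (m + 2) : ℕ))
    (hmem : ∀ m, (X : PowerSeries (A ⧸ Ideal.span {π})) ^ (3 * 4 ^ m) ∣ Z m - Polynomial.aeval (s m) (P m))
    {m₀ a₀ : ℕ} (ha₀ : (S m₀).order = a₀) (hnd : a₀ + 2 < 4 ^ (m₀ + 1))
    {m : ℕ} (hm : m₀ + 2 ≤ m) : ∃ i, Odd i ∧ (P m).coeff i ≠ 0 := by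
  haveI : CharP (A ⧸ Ideal.span {π}) 2 := charP_two_of_isLTRing_four hA
  -- the translations `y_m = ([w_m]‾)^{4^{m+1}}`
  have hy0 : ∀ n, constantCoeff (((LubinTate.hom hA hf hf (w n)).map (Ideal.Quotient.mk (Ideal.span {π}))) ^
      (4 ^ (n + 1))) = 0 := fun n => constantCoeff_pow_map_hom hA hf (n + 1) (w n)
  have hy' : ∀ n, d⁄dX (A ⧸ Ideal.span {π}) (((LubinTate.hom hA hf hf (w n)).map
      (Ideal.Quotient.mk (Ideal.span {π}))) ^ (4 ^ (n + 1))) = 0 := fun n =>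
    derivative_pow_map_hom_eq_zero hA hf (by omega) (w n)
  have hyord : ∀ n, (((LubinTate.hom hA hf hf (w n)).map (Ideal.Quotient.mk (Ideal.span {π}))) ^
      (4 ^ (n + 1))).order = (4 ^ (n + 1) : ℕ) := fun n => order_pow_map_hom hA hf (n + 1) (hw n)
  -- `[h_m]‾ = t ⊕ y_m`
  have hφ : ∀ n, (LubinTate.hom hA hf hf (1 + π ^ (n + 1) * w n)).map (Ideal.Quotient.mk (Ideal.span {π})) =
      MvPowerSeries.subst ![((LubinTate.hom hA hf hf (w n)).map (Ideal.Quotient.mk (Ideal.span {π}))) ^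
        (4 ^ (n + 1)), (X : PowerSeries (A ⧸ Ideal.span {π}))]
        (U.map (Ideal.Quotient.mk (Ideal.span {π}))).formalGroupLaw := fun n =>
    map_hom_one_add_pow_mul_formalGroupLaw hA hf U hU (n + 1) (w n)
  -- the shapes `t ⊕ y_m = t + η̄ y_m + y_m² r_m`
  have hr : ∀ n, ∃ r : PowerSeries (A ⧸ Ideal.span {π}),
      MvPowerSeries.subst ![((LubinTate.hom hA hf hf (w n)).map (Ideal.Quotient.mk (Ideal.span {π}))) ^
        (4 ^ (n + 1)), (X : PowerSeries (A ⧸ Ideal.span {π}))]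
        (U.map (Ideal.Quotient.mk (Ideal.span {π}))).formalGroupLaw =
      X + (U.map (Ideal.Quotient.mk (Ideal.span {π}))).formalEta *
        ((LubinTate.hom hA hf hf (w n)).map (Ideal.Quotient.mk (Ideal.span {π}))) ^ (4 ^ (n + 1)) +
      (((LubinTate.hom hA hf hf (w n)).map (Ideal.Quotient.mk (Ideal.span {π}))) ^ (4 ^ (n + 1))) ^ 2 * r :=
    fun n => exists_translate_eq _ (hy0 n)
  choose r hr using hr
  refine oddDigit_of_nonDeg_of_levelStep (u := (U.map (Ideal.Quotient.mk (Ideal.span {π}))).formalEta)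
    (derivative_formalEta_eq_zero _ ha₁) Z S
    (fun n => ((LubinTate.hom hA hf hf (w n)).map (Ideal.Quotient.mk (Ideal.span {π}))) ^ (4 ^ (n + 1))) r
    (fun n => MvPowerSeries.subst ![((LubinTate.hom hA hf hf (w n)).map (Ideal.Quotient.mk (Ideal.span {π}))) ^
        (4 ^ (n + 1)), (X : PowerSeries (A ⧸ Ideal.span {π}))] (U.map (Ideal.Quotient.mk (Ideal.span {π}))).formalGroupLaw)
    s P hZ hZS hr (fun n => formalEta_mul_derivative_translate _ (hy0 n) (hy' n)) (fun n => ?_) hyord hZord hmem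
    ha₀ hnd hm
  rw [hZstep, hφ]

end Summit.BirchSwinnertonDyer.BirchSwinnertonDyer.Theorems.SignedMuAtTwo.Tilt

end
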